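import Mathlib
import HarnessLib
import Literature.Algebra.EuclideanLattices.FccBccLattices
import Summits.AtomisticToContinuum.Crystallization.Theorems.PricedLinkCensusSoftLayerPropagationStubMetricDet
import Summits.AtomisticToContinuum.Crystallization.Theorems.PricedLinkCensusSoftLayerPropagationHXLensB

/-!
# The rhombus of a hexagon-opposite pair is nearly flat (crux `SoftLayerPropagation`, line `Sketch`)

Route `PricedLinkCensus`, crux `SoftLayerPropagation` (stmt-AtomisticToContinuum-14233), line
`Sketch`, helper file for the stub `develop_HX_fcc` (local no-merge, HEXAGON-OPPOSITE case):
registered sub-goal `hx_rhombus`.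

**The rhombus lemma (unit scale).**  Five points `x, w, u, p, k` of `ℝ³` with the eight squared
"bond" distances `xw, ux, uw, px, pw, kx, kw, up` in `[1, 1 + 13/200]`, the squared distance `pk` in
the diagonal window `[2 − 2α − 21α²/2, 2 + 4α + 6α²]` (`α = 13/200`) of the octahedron lemma, and
`‖u − k‖² ≥ 1` (hard core).  Then `‖(2u − x − w) + (2k − x − w)‖² < 7/10`: the rhombus `x u w k`
(two contact triangles on the bond `x w`) is flat to within `0.21` in the position of the midpoint
of `u k` — in the exact FCC geometry `u + k = x + w` (`u, k` opposite across the hexagon through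
`u, w, k` of the link of `x`, `p` the third vertex of the contact triangle `x u w`… of `u w`, and
`p k` a square diagonal).

Proof.  With `U = 2u−x−w`, `P = 2p−x−w`, `K = 2k−x−w`, `D = x − w` all inner products but
`σ = ⟪U, K⟫` are read off the distances by polarisation; `U, P, K` are nearly orthogonal to `D`, so
the product identity `det(U,P,K)·det(U,P,D) = det(⟪·,·⟫)` (`det3_mul_det3`) bounds
`det(U,P,K)² ≤ 0.724`, while its Gram expansion is a concave quadratic `q(σ)` whose value exceeds
`2.2` between `σ₁ = (7/10 − ‖U‖² − ‖K‖²)/2` and the hard-core value `(‖U‖² + ‖K‖²)/2 − 2`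
(checked at the two ends: `rhombus_endpoint_one/two`); hence `σ < σ₁`, i.e. `‖U + K‖² < 7/10`.
All `[folklore]`.
-/

noncomputable section

namespace Summit.AtomisticToContinuum.Crystallization.Theorems

open Literature.Geometry.DiscreteGeometry

/-! ### Polarisation -/

/-- Polarisation bookkeeping for the rhombus lemma: norms and inner products of
`U = (u−x)+(u−w)`, `P = (p−x)+(p−w)`, `K = (k−x)+(k−w)` and `D = x − w` in terms of the ten
squared distances. [folklore] -/
theorem rhombus_identities (x w u p k : EuclideanSpace ℝ (Fin 3)) :
    ‖u - x + (u - w)‖ ^ 2 = 2 * ‖u - x‖ ^ 2 + 2 * ‖u - w‖ ^ 2 - ‖x - w‖ ^ 2 ∧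
    ‖p - x + (p - w)‖ ^ 2 = 2 * ‖p - x‖ ^ 2 + 2 * ‖p - w‖ ^ 2 - ‖x - w‖ ^ 2 ∧
    ‖k - x + (k - w)‖ ^ 2 = 2 * ‖k - x‖ ^ 2 + 2 * ‖k - w‖ ^ 2 - ‖x - w‖ ^ 2 ∧
    inner ℝ (u - x + (u - w)) (x - w) = ‖u - w‖ ^ 2 - ‖u - x‖ ^ 2 ∧
    inner ℝ (p - x + (p - w)) (x - w) = ‖p - w‖ ^ 2 - ‖p - x‖ ^ 2 ∧
    inner ℝ (k - x + (k - w)) (x - w) = ‖k - w‖ ^ 2 - ‖k - x‖ ^ 2 ∧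
    inner ℝ (u - x + (u - w)) (p - x + (p - w)) =
      ‖u - x‖ ^ 2 + ‖u - w‖ ^ 2 + ‖p - x‖ ^ 2 + ‖p - w‖ ^ 2 - ‖x - w‖ ^ 2 - 2 * ‖u - p‖ ^ 2 ∧
    inner ℝ (p - x + (p - w)) (k - x + (k - w)) =
      ‖p - x‖ ^ 2 + ‖p - w‖ ^ 2 + ‖k - x‖ ^ 2 + ‖k - w‖ ^ 2 - ‖x - w‖ ^ 2 - 2 * ‖p - k‖ ^ 2 ∧
    inner ℝ (u - x + (u - w)) (k - x + (k - w)) =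
      ‖u - x‖ ^ 2 + ‖u - w‖ ^ 2 + ‖k - x‖ ^ 2 + ‖k - w‖ ^ 2 - ‖x - w‖ ^ 2 - 2 * ‖u - k‖ ^ 2 ∧
    ‖u - x + (u - w) + (k - x + (k - w))‖ ^ 2 = ‖u - x + (u - w)‖ ^ 2 + ‖k - x + (k - w)‖ ^ 2 +
      2 * inner ℝ (u - x + (u - w)) (k - x + (k - w)) := by
  simp only [Literature.Algebra.EuclideanLattices.inner_fin_three,
    Literature.Algebra.EuclideanLattices.norm_sq_fin_three, PiLp.add_apply, PiLp.sub_apply]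
  refine ⟨by ring, by ring, by ring, by ring, by ring, by ring, by ring, by ring, by ring, by ring⟩

/-! ### The two endpoint checks (pure real arithmetic over a box) -/

/-- The `c`-dependent part of the Gram quadratic at the lower endpoint `σ₁`: a concave quadratic form in
`(c_UP, c_PK)` whose corner values are affine in `(N_U, N_K)`; bounded below by `−3.39` over the box.
[folklore] -/
theorem rhombus_bracket_one {NU NK cUP cPK : ℝ} (hNU : 2935 / 1000 ≤ NU) (hNU' : NU ≤ 326 / 100)
    (hNK : 2935 / 1000 ≤ NK) (hNK' : NK ≤ 326 / 100) (hcUP : 805 / 1000 ≤ cUP) (hcUP' : cUP ≤ 126 / 100)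
    (hcPK : -(16357 / 10000) ≤ cPK) (hcPK' : cPK ≤ -(3912 / 10000)) :
    -(339 / 100) ≤ cUP * cPK * (7 / 10 - NU - NK) - NU * cPK ^ 2 - NK * cUP ^ 2 := by
  -- the four corners of the `(c_UP, c_PK)` rectangle (affine in `N_U, N_K`)
  have kll : -(339 / 100) ≤ (805 / 1000 : ℝ) * (-(16357 / 10000)) * (7 / 10 - NU - NK) -
      NU * (-(16357 / 10000)) ^ 2 - NK * (805 / 1000) ^ 2 := by linarith
  have klh : -(339 / 100) ≤ (805 / 1000 : ℝ) * (-(3912 / 10000)) * (7 / 10 - NU - NK) -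
      NU * (-(3912 / 10000)) ^ 2 - NK * (805 / 1000) ^ 2 := by linarith
  have khl : -(339 / 100) ≤ (126 / 100 : ℝ) * (-(16357 / 10000)) * (7 / 10 - NU - NK) -
      NU * (-(16357 / 10000)) ^ 2 - NK * (126 / 100) ^ 2 := by linarith
  have khh : -(339 / 100) ≤ (126 / 100 : ℝ) * (-(3912 / 10000)) * (7 / 10 - NU - NK) -
      NU * (-(3912 / 10000)) ^ 2 - NK * (126 / 100) ^ 2 := by linarith
  have hNU0 : 0 ≤ NU := by linarith
  have hNK0 : 0 ≤ NK := by linarith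
  have p1 : 0 ≤ cPK - -(16357 / 10000) := by linarith
  have p2 : 0 ≤ -(3912 / 10000) - cPK := by linarith
  have p3 : 0 ≤ cUP - 805 / 1000 := by linarith
  have p4 : 0 ≤ 126 / 100 - cUP := by linarith
  -- concavity in `c_PK` (coefficient `−N_U`) on the two edges `c_UP = 0.805`, `c_UP = 1.26`
  have kl : -(339 / 100) ≤ (805 / 1000 : ℝ) * cPK * (7 / 10 - NU - NK) - NU * cPK ^ 2 -
      NK * (805 / 1000) ^ 2 := by
    nlinarith [mul_nonneg (mul_nonneg hNU0 p1) p2, mul_nonneg p1 p2, kll, klh,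
      mul_le_mul_of_nonneg_left kll p2, p1, p2]
  have kh : -(339 / 100) ≤ (126 / 100 : ℝ) * cPK * (7 / 10 - NU - NK) - NU * cPK ^ 2 -
      NK * (126 / 100) ^ 2 := by
    nlinarith [mul_nonneg (mul_nonneg hNU0 p1) p2, mul_nonneg p1 p2, khl, khh, p1, p2]
  -- concavity in `c_UP` (coefficient `−N_K`)
  nlinarith [mul_nonneg (mul_nonneg hNK0 p3) p4, mul_nonneg p3 p4, kl, kh, p3, p4]

/-- The lower endpoint check: `q(σ₁) ≥ 2.2` for `σ₁ = (7/10 − N_U − N_K)/2` over the box. [folklore] -/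
theorem rhombus_endpoint_one {NU NP NK cUP cPK : ℝ} (hNU : 2935 / 1000 ≤ NU) (hNU' : NU ≤ 326 / 100)
    (hNP : 2935 / 1000 ≤ NP) (_hNP' : NP ≤ 326 / 100) (hNK : 2935 / 1000 ≤ NK) (hNK' : NK ≤ 326 / 100)
    (hcUP : 805 / 1000 ≤ cUP) (hcUP' : cUP ≤ 126 / 100) (hcPK : -(16357 / 10000) ≤ cPK)
    (hcPK' : cPK ≤ -(3912 / 10000)) :
    22 / 10 ≤ NU * NP * NK + 2 * cUP * ((7 / 10 - NU - NK) / 2) * cPK - NU * cPK ^ 2 -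
      NP * ((7 / 10 - NU - NK) / 2) ^ 2 - NK * cUP ^ 2 := by
  have b2 := rhombus_bracket_one hNU hNU' hNK hNK' hcUP hcUP' hcPK hcPK'
  have b1 : 19055 / 10000 ≤ NU * NK - ((7 / 10 - NU - NK) / 2) ^ 2 := by nlinarith
  have b1' : 2935 / 1000 * (19055 / 10000) ≤ NP * (NU * NK - ((7 / 10 - NU - NK) / 2) ^ 2) := by
    nlinarith
  nlinarith [b1', b2]

/-- The upper (hard-core) endpoint check: `q(σ₂) ≥ 2.2` for `σ₂ = (N_U + N_K)/2 − 2` over the box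
(crude bounds suffice). [folklore] -/
theorem rhombus_endpoint_two {NU NP NK cUP cPK : ℝ} (hNU : 2935 / 1000 ≤ NU) (hNU' : NU ≤ 326 / 100)
    (hNP : 2935 / 1000 ≤ NP) (_hNP' : NP ≤ 326 / 100) (hNK : 2935 / 1000 ≤ NK) (hNK' : NK ≤ 326 / 100)
    (hcUP : 805 / 1000 ≤ cUP) (hcUP' : cUP ≤ 126 / 100) (hcPK : -(16357 / 10000) ≤ cPK)
    (hcPK' : cPK ≤ -(3912 / 10000)) :
    22 / 10 ≤ NU * NP * NK + 2 * cUP * ((NU + NK) / 2 - 2) * cPK - NU * cPK ^ 2 -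
      NP * ((NU + NK) / 2 - 2) ^ 2 - NK * cUP ^ 2 := by
  have b1 : 771 / 100 ≤ NU * NK - ((NU + NK) / 2 - 2) ^ 2 := by nlinarith
  have b1' : 2935 / 1000 * (771 / 100) ≤ NP * (NU * NK - ((NU + NK) / 2 - 2) ^ 2) := by nlinarith
  have c1 : -(2061 / 1000) ≤ cUP * cPK := by nlinarith
  have c2 : cUP * cPK * ((NU + NK) / 2 - 2) ≥ -(2061 / 1000) * (126 / 100) := by
    have h0 : 0 ≤ (NU + NK) / 2 - 2 := by linarith
    have h1 : (NU + NK) / 2 - 2 ≤ 126 / 100 := by linarith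
    nlinarith [mul_le_mul_of_nonneg_right c1 h0]
  have c3 : NU * cPK ^ 2 ≤ 326 / 100 * (16357 / 10000) ^ 2 := by
    have : cPK ^ 2 ≤ (16357 / 10000) ^ 2 := by nlinarith
    nlinarith
  have c4 : NK * cUP ^ 2 ≤ 326 / 100 * (126 / 100) ^ 2 := by
    have : cUP ^ 2 ≤ (126 / 100) ^ 2 := by nlinarith
    nlinarith
  nlinarith [b1', c2, c3, c4]

/-- A concave quadratic exceeds `m` between two points where it exceeds `m`. [folklore] -/
theorem concave_quadratic_ge {A B C l h s m : ℝ} (hA : 0 ≤ A) (hl : l ≤ s) (hh : s ≤ h) (hlh : l < h)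
    (h₁ : m ≤ -A * l ^ 2 + B * l + C) (h₂ : m ≤ -A * h ^ 2 + B * h + C) :
    m ≤ -A * s ^ 2 + B * s + C := by
  have key : (h - l) * (-A * s ^ 2 + B * s + C) - (h - s) * (-A * l ^ 2 + B * l + C) -
      (s - l) * (-A * h ^ 2 + B * h + C) = A * (h - s) * (s - l) * (h - l) := by ring
  have hpos : 0 ≤ A * (h - s) * (s - l) * (h - l) := by
    have := mul_nonneg (mul_nonneg (mul_nonneg hA (sub_nonneg.2 hh)) (sub_nonneg.2 hl)) (sub_nonneg.2 hlh.le)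
    linarith
  nlinarith [mul_le_mul_of_nonneg_left h₁ (sub_nonneg.2 hh), mul_le_mul_of_nonneg_left h₂ (sub_nonneg.2 hl)]

/-! ### The rhombus lemma -/

set_option maxHeartbeats 800000 in
/-- **Registered sub-goal `hx_rhombus`: the rhombus of a hexagon-opposite pair is nearly flat (unit
scale).**  Eight squared bonds in `[1, 1 + 13/200]`, the square diagonal `pk` in the octahedron window,
`‖u − k‖² ≥ 1` ⇒ `‖(2u − x − w) + (2k − x − w)‖² < 7/10`. [folklore] -/
theorem hx_rhombus : ∀ (x w u p k : EuclideanSpace ℝ (Fin 3)),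
    1 ≤ ‖x - w‖ ^ 2 → ‖x - w‖ ^ 2 ≤ 1 + 13 / 200 → 1 ≤ ‖u - x‖ ^ 2 → ‖u - x‖ ^ 2 ≤ 1 + 13 / 200 →
    1 ≤ ‖u - w‖ ^ 2 → ‖u - w‖ ^ 2 ≤ 1 + 13 / 200 → 1 ≤ ‖p - x‖ ^ 2 → ‖p - x‖ ^ 2 ≤ 1 + 13 / 200 →
    1 ≤ ‖p - w‖ ^ 2 → ‖p - w‖ ^ 2 ≤ 1 + 13 / 200 → 1 ≤ ‖k - x‖ ^ 2 → ‖k - x‖ ^ 2 ≤ 1 + 13 / 200 →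
    1 ≤ ‖k - w‖ ^ 2 → ‖k - w‖ ^ 2 ≤ 1 + 13 / 200 → 1 ≤ ‖u - p‖ ^ 2 → ‖u - p‖ ^ 2 ≤ 1 + 13 / 200 →
    2 - 2 * (13 / 200) - 21 / 2 * (13 / 200) ^ 2 ≤ ‖p - k‖ ^ 2 →
    ‖p - k‖ ^ 2 ≤ 2 + 4 * (13 / 200) + 6 * (13 / 200) ^ 2 → 1 ≤ ‖u - k‖ ^ 2 →
    ‖u - x + (u - w) + (k - x + (k - w))‖ ^ 2 < 7 / 10 := by
  intro x w u p k hxw hxw' hux hux' huw huw' hpx hpx' hpw hpw' hkx hkx' hkw hkw' hup hup' hpk hpk' huk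
  -- a product bound (cf. `Literature.Analysis.FluidPDE.CompressibleEuler.abs_mul_le_of_le`)
  have amul : ∀ {a b A B : ℝ}, |a| ≤ A → |b| ≤ B → |a * b| ≤ A * B :=
    fun ha hb => by rw [abs_mul]; exact mul_le_mul ha hb (abs_nonneg _) ((abs_nonneg _).trans ha)
  obtain ⟨e1, e2, e3, e4, e5, e6, e7, e8, e9, e10⟩ := rhombus_identities x w u p k
  have epr := det3_mul_det3 (u - x + (u - w)) (p - x + (p - w)) (k - x + (k - w))
    (u - x + (u - w)) (p - x + (p - w)) (x - w)
  have egK := det3_sq_eq_gram (u - x + (u - w)) (p - x + (p - w)) (k - x + (k - w))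
  have egD := det3_sq_eq_gram (u - x + (u - w)) (p - x + (p - w)) (x - w)
  generalize hU : u - x + (u - w) = U at *
  generalize hP : p - x + (p - w) = P at *
  generalize hK : k - x + (k - w) = K at *
  generalize hD : x - w = D at *
  norm_num at hpk hpk'
  -- ranges
  have NUl : 2935 / 1000 ≤ ‖U‖ ^ 2 := by rw [e1]; linarith only [hux, huw, hxw']
  have NUh : ‖U‖ ^ 2 ≤ 326 / 100 := by rw [e1]; linarith only [hux', huw', hxw]
  have NPl : 2935 / 1000 ≤ ‖P‖ ^ 2 := by rw [e2]; linarith only [hpx, hpw, hxw']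
  have NPh : ‖P‖ ^ 2 ≤ 326 / 100 := by rw [e2]; linarith only [hpx', hpw', hxw]
  have NKl : 2935 / 1000 ≤ ‖K‖ ^ 2 := by rw [e3]; linarith only [hkx, hkw, hxw']
  have NKh : ‖K‖ ^ 2 ≤ 326 / 100 := by rw [e3]; linarith only [hkx', hkw', hxw]
  have dU : |inner ℝ U D| ≤ 13 / 200 := by
    rw [e4]; exact abs_le.2 ⟨by linarith only [huw, hux'], by linarith only [huw', hux]⟩
  have dP : |inner ℝ P D| ≤ 13 / 200 := by
    rw [e5]; exact abs_le.2 ⟨by linarith only [hpw, hpx'], by linarith only [hpw', hpx]⟩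
  have dK : |inner ℝ K D| ≤ 13 / 200 := by
    rw [e6]; exact abs_le.2 ⟨by linarith only [hkw, hkx'], by linarith only [hkw', hkx]⟩
  have cUPl : 805 / 1000 ≤ inner ℝ U P := by rw [e7]; linarith only [hux, huw, hpx, hpw, hxw', hup']
  have cUPh : inner ℝ U P ≤ 126 / 100 := by rw [e7]; linarith only [hux', huw', hpx', hpw', hxw, hup]
  have cPKl : -(16357 / 10000) ≤ inner ℝ P K := by
    rw [e8]; linarith only [hpx, hpw, hkx, hkw, hxw', hpk']
  have cPKh : inner ℝ P K ≤ -(3912 / 10000) := by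
    rw [e8]; linarith only [hpx', hpw', hkx', hkw', hxw, hpk]
  have hσ : inner ℝ U K ≤ (‖U‖ ^ 2 + ‖K‖ ^ 2) / 2 - 2 := by rw [e9, e1, e3]; linarith only [huk]
  have σabs : |inner ℝ U K| ≤ 326 / 100 := by
    refine (abs_real_inner_le_norm U K).trans ?_
    nlinarith only [NUh, NKh, norm_nonneg U, norm_nonneg K]
  have cUPabs : |inner ℝ U P| ≤ 126 / 100 := abs_le.2 ⟨by linarith only [cUPl], cUPh⟩
  have cPKabs : |inner ℝ P K| ≤ 16357 / 10000 := abs_le.2 ⟨cPKl, by linarith only [cPKh]⟩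
  have NUabs : |inner ℝ U U| ≤ 326 / 100 := by
    rw [real_inner_self_eq_norm_sq, abs_of_nonneg (sq_nonneg _)]; exact NUh
  have NPabs : |inner ℝ P P| ≤ 326 / 100 := by
    rw [real_inner_self_eq_norm_sq, abs_of_nonneg (sq_nonneg _)]; exact NPh
  -- the product identity: `|det(U,P,K) det(U,P,D)| ≤ 2.2324`
  have Rle : |Matrix.det ![WithLp.ofLp U, WithLp.ofLp P, WithLp.ofLp K] *
      Matrix.det ![WithLp.ofLp U, WithLp.ofLp P, WithLp.ofLp D]| ≤ 22324 / 10000 := by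
    rw [epr]
    have cPU : |inner ℝ P U| ≤ 126 / 100 := by rw [real_inner_comm]; exact cUPabs
    have cKP : |inner ℝ K P| ≤ 16357 / 10000 := by rw [real_inner_comm]; exact cPKabs
    have cKU : |inner ℝ K U| ≤ 326 / 100 := by rw [real_inner_comm]; exact σabs
    have t1 : |inner ℝ U U * (inner ℝ P P * inner ℝ K D - inner ℝ P D * inner ℝ K P)| ≤
        326 / 100 * (326 / 100 * (13 / 200) + 13 / 200 * (16357 / 10000)) :=
      amul NUabs ((abs_sub _ _).trans (add_le_add (amul NPabs dK) (amul dP cKP)))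
    have t2 : |inner ℝ U P * (inner ℝ P U * inner ℝ K D - inner ℝ P D * inner ℝ K U)| ≤
        126 / 100 * (126 / 100 * (13 / 200) + 13 / 200 * (326 / 100)) :=
      amul cUPabs ((abs_sub _ _).trans (add_le_add (amul cPU dK) (amul dP cKU)))
    have t3 : |inner ℝ U D * (inner ℝ P U * inner ℝ K P - inner ℝ P P * inner ℝ K U)| ≤
        13 / 200 * (126 / 100 * (16357 / 10000) + 326 / 100 * (326 / 100)) :=
      amul dU ((abs_sub _ _).trans (add_le_add (amul cPU cKP) (amul NPabs cKU)))
    have := (abs_add_le _ _).trans (add_le_add ((abs_sub _ _).trans (add_le_add t1 t2)) t3)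
    exact this.trans (by norm_num)
  -- `det(U,P,D)²` is large
  have gD : 6885 / 1000 ≤ Matrix.det ![WithLp.ofLp U, WithLp.ofLp P, WithLp.ofLp D] ^ 2 := by
    rw [egD]
    have hdU := abs_le.1 dU; have hdP := abs_le.1 dP
    have ND1 : 1 ≤ ‖D‖ ^ 2 := hxw
    have ND2 : ‖D‖ ^ 2 ≤ 1 + 13 / 200 := hxw'
    have q1 : (2935 / 1000) ^ 2 * 1 ≤ ‖U‖ ^ 2 * ‖P‖ ^ 2 * ‖D‖ ^ 2 := by
      have : (2935 / 1000) ^ 2 ≤ ‖U‖ ^ 2 * ‖P‖ ^ 2 := by nlinarith only [NUl, NPl]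
      nlinarith only [this, ND1]
    have q2 : -(126 / 100 * (13 / 200) * (13 / 200)) ≤ inner ℝ U P * inner ℝ U D * inner ℝ P D :=
      (abs_le.1 (amul (amul cUPabs dU) dP)).1
    have q3 : ‖U‖ ^ 2 * inner ℝ P D ^ 2 ≤ 326 / 100 * (13 / 200) ^ 2 := by
      have : inner ℝ P D ^ 2 ≤ (13 / 200) ^ 2 := by nlinarith only [hdP]
      nlinarith only [this, NUh, sq_nonneg ‖U‖, sq_nonneg (inner ℝ P D)]
    have q4 : ‖P‖ ^ 2 * inner ℝ U D ^ 2 ≤ 326 / 100 * (13 / 200) ^ 2 := by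
      have : inner ℝ U D ^ 2 ≤ (13 / 200) ^ 2 := by nlinarith only [hdU]
      nlinarith only [this, NPh, sq_nonneg ‖P‖, sq_nonneg (inner ℝ U D)]
    have q5 : ‖D‖ ^ 2 * inner ℝ U P ^ 2 ≤ (1 + 13 / 200) * (126 / 100) ^ 2 := by
      have : inner ℝ U P ^ 2 ≤ (126 / 100) ^ 2 := by nlinarith only [cUPl, cUPh]
      nlinarith only [this, ND2, ND1, sq_nonneg (inner ℝ U P)]
    linarith only [q1, q2, q3, q4, q5]
  -- hence `det(U,P,K)² ≤ 0.724`
  have gK : Matrix.det ![WithLp.ofLp U, WithLp.ofLp P, WithLp.ofLp K] ^ 2 ≤ 724 / 1000 := by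
    have h := abs_le.1 Rle
    have hsq : (Matrix.det ![WithLp.ofLp U, WithLp.ofLp P, WithLp.ofLp K] *
        Matrix.det ![WithLp.ofLp U, WithLp.ofLp P, WithLp.ofLp D]) ^ 2 ≤ (22324 / 10000) ^ 2 := by
      nlinarith only [h]
    rw [mul_pow] at hsq
    nlinarith only [hsq, gD, sq_nonneg (Matrix.det ![WithLp.ofLp U, WithLp.ofLp P, WithLp.ofLp K])]
  -- the Gram quadratic in `σ = ⟪U, K⟫`
  rw [egK] at gK
  by_contra h7
  push Not at h7
  have σlo : (7 / 10 - ‖U‖ ^ 2 - ‖K‖ ^ 2) / 2 ≤ inner ℝ U K := by linarith only [h7, e10]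
  have q1 := rhombus_endpoint_one NUl NUh NPl NPh NKl NKh cUPl cUPh cPKl cPKh
  have q2 := rhombus_endpoint_two NUl NUh NPl NPh NKl NKh cUPl cUPh cPKl cPKh
  have hq := concave_quadratic_ge (A := ‖P‖ ^ 2) (B := 2 * inner ℝ U P * inner ℝ P K)
    (C := ‖U‖ ^ 2 * ‖P‖ ^ 2 * ‖K‖ ^ 2 - ‖U‖ ^ 2 * inner ℝ P K ^ 2 - ‖K‖ ^ 2 * inner ℝ U P ^ 2)
    (m := 22 / 10) (sq_nonneg _) σlo hσ (by linarith only [NUl, NKl]) (by linarith only [q1])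
    (by linarith only [q2])
  linarith only [hq, gK]

end Summit.AtomisticToContinuum.Crystallization.Theorems

end
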